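import Literature.NumberTheory.GaloisRepresentations.GSp4BigImage
import HarnessLib

/-!
# `GSp₄`-adequate subgroups and `GSp₄`-reasonable representations
# (Whitmore, *The Taylor–Wiles method for reductive groups*, Def. 3.15 and Def. 3.19, for `Ĝ = GSp₄`)

Topic `Literature/NumberTheory/GaloisRepresentations`, sibling of `GSp4BigImage.lean` (BCGP 2021
§7.5: enormous / vast / tidy) and `EnormousSubgroup.lean`.  DEFINITIONS with bodies and unfolding
API only (D-0026: no named fact).  They render, for the split group `Ĝ = GSp₄ = GSp(J) ⊂ GL₄`
(`J` the Gram matrix of the symplectic form, as in `GSp4BigImage.lean`), the two "big image"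
notions of D. Whitmore, *The Taylor–Wiles method for reductive groups*, arXiv:2205.05062
(v4, 2026; published Adv. Math. 493 (2026)) — Definition 3.15 ("`Ĝ`-adequate", printed p. 22)
and Definition 3.19 ("`Ĝ`-reasonable", printed pp. 23–24) — which are the hypothesis
"`ρ̄` is `GSp₄`-reasonable in the sense of [Whitmore, Defn. 3.19]" of Boxer–Calegari–Gee–Pilloni
2025, Lemma 6.4.3 (1) and Theorem 9.5.1 (5) (arXiv:2502.20645), vendored so that their
Theorem 9.5.2 (modularity of abelian surfaces over `ℚ` whose mod-`3` image is one of the 15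
subgroups of Table 6.4.4) can be typed as printed for the venture cell `pub-residmod`
(`run/shared/lean/pub/pub-residmod/lit/BCGP-AS-PRINTED.md`, §B2–B3).

## The printed definitions (arXiv:2205.05062v4; printed pages as in the running headers)

* Notation (§1 p. 3 L20–22; §2 p. 7): "`ĝ⁰` denotes the Lie algebra of the derived group of `Ĝ`
  … equipped with the adjoint action of `Ĝ`, `ĝ^{0,∨}` denotes the dual module and `𝔷` denotes
  the center of a Lie algebra."  "let `ḡ ∈ Ĝ(k)` be a semisimple element with centralizer
  `M_ḡ = Z_{Ĝ_k}(ḡ)`, a possibly disconnected smooth closed `k`-subgroup with reductive identity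
  component ([Con14, Theorem 1.1.19]) … We have the equality of Lie algebras `Lie M_ḡ = 𝔏₀`"
  (`𝔏₀ = {v ∈ ĝ_k : Ad(ḡ)(v) = v}`).
* **Def. 3.15 (p. 22 L6–13).** "We say `H ≤ Ĝ(k)` is `Ĝ`-adequate if the following conditions
  hold: (1) The following groups vanish (a) `H⁰(H, ĝ^{0,∨}_k)` (b) `H¹(H, k)` (c) `H¹(H, ĝ^{0,∨}_k)`
  (2) For every non-zero simple `k[H]`-submodule `W ≤ ĝ^{0,∨}_k` there exists a semisimple
  element `h ∈ H` such that for some `w ∈ W` and `z ∈ Lie Z(M_h) ∩ ĝ⁰_k` we have `w(z) ≠ 0`."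
  (ibid. L14–19: "When `M_h` is connected we may write `Lie Z(M_h) ∩ ĝ⁰_k = 𝔷((ĝ⁰_k)^h)` by
  Lemma 2.7. If moreover `h ∈ H` is regular semisimple … the centralizer of `h` is a maximal torus
  and `𝔷((ĝ⁰_k)^h) = (ĝ⁰_k)^h`"; §4.3 p. 39 calls (2) "our spanning condition".)
* **Def. 3.19 (p. 23 L53 – p. 24 L4).** "A Galois representation `ρ̄ : G_F → Ĝ(k)` is said to be
  `Ĝ`-reasonable if the following conditions hold for all sufficiently large `n` (1)
  `ρ̄(G_{F(ζ_{p^n})}) ⊂ Ĝ(k)` satisfies conditions 1a and 2 of Definition 3.15 (2) if `ζ_p` is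
  in the fixed field of `ĝ^{0,∨}_k` then `H¹(ρ̄(G_{F(ζ_{p^n})}), ĝ^{0,∨}_k) = 0`."  (Lemma 3.16,
  p. 22: "Let `L` be the fixed field of the module `ĝ^{0,∨}_k`"; Lemma 3.20, p. 24: "if
  `ρ̄(G_{F(ζ_p)})` is `Ĝ`-adequate then `ρ̄` is `Ĝ`-reasonable" when `H¹(ρ̄(G_{F(ζ_p)}), k) = 0`.)

## What is here (all with bodies; `k` a field, `J ∈ M_n(k)`)

* `gspLie J` — `𝔤𝔰𝔭(J) = Lie GSp(J) = {X : ∃ c, Xᵀ J + J X = c J}` (`k[ε]`-points of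
  `GSp(J) = {g : gᵀ J g = ν J}`); it contains `spLie J = 𝔰𝔭(J)` (`spLie_le_gspLie`), which for
  `n = 4`, `J` invertible alternating and `char k ≠ 2` is Whitmore's `ĝ⁰ = Lie Sp₄` — the SAME
  module `ad⁰` as in `GSp4BigImage.lean` (BCGP Def. 7.5.2).
* `IsSemisimpleElt g` — "`h` semisimple": `g ∈ GL_n(k)` is annihilated by a separable polynomial
  (equivalently, diagonalisable over `k̄`); an element of finite order `m` prime to `char k` is
  semisimple, being killed by the separable `X ^ m − 1` (Mathlib `Polynomial.separable_X_pow_sub_C`).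
* `lieCenterCentralizer J h ≤ gspLie J` — **`Lie Z(M_h)`** for `M_h = Z_{GSp(J)_k}(h)`, rendered in
  matrices: the `X ∈ 𝔤𝔰𝔭(J)_k` commuting with `h` (`X ∈ Lie M_h = ĝ_k^{Ad h}`) such that
  `m X m⁻¹ = X` for every `m ∈ GSp(J)(k̄)` commuting with `h`, `k̄ = AlgebraicClosure k`.  READING
  (reviewers): for a smooth affine `k`-group `M`, `Lie Z(M) = {X ∈ Lie M : Ad(m) X = X for all
  `m ∈ M(R)`, all `k`-algebras `R`}` (compute the `k[ε]`-points of the scheme-theoretic centre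
  `Z(M) = {z : z m = m z ∀ m}`: `(1 + εX) m = m (1 + εX) ⟺ ε(Xm − mX) = 0`), and since `M_h` is
  SMOOTH for semisimple `h` (quoted above) the stabiliser of `X` in `M_h`, a closed subgroup scheme
  containing every `k̄`-point, is all of `M_h`; so invariance under `M_h(k̄) =
  {m ∈ GSp(J)(k̄) : m h = h m}` is exactly the printed `Lie Z(M_h)`.  For non-semisimple `h` the
  set is still defined but is not claimed to be `Lie Z(M_h)`; Def. 3.15 (2) only uses semisimple `h`.
* `Subgroup.spDualRep H hH` — the `k[H]`-module `ĝ^{0,∨}_k = 𝔰𝔭(J)^∨` (Mathlib `Representation.dual`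
  of `Subgroup.spAdRep H hH`, `(h · w)(z) = w(h⁻¹ z h)`), for `H ≤ GSp(J)(k)`.
* `Subgroup.SpDualInvariantsEqBot J H hH` — Def. 3.15 (1a): `H⁰(H, 𝔰𝔭(J)^∨) = 0`.
  `Subgroup.HasGSp4Spanning J H hH` — Def. 3.15 (2) (the "spanning condition"): for every simple
  `k[H]`-submodule `W` of `𝔰𝔭(J)^∨` (an atom of the subrepresentation lattice, as in the siblings)
  some semisimple `h ∈ H`, `w ∈ W`, `z ∈ Lie Z(M_h) ∩ 𝔰𝔭(J)` have `w(z) ≠ 0`.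
  `Subgroup.IsGSp4Adequate J H` — Def. 3.15 in full: `H ≤ GSp(J)(k)`, (1a), (1b) `H¹(H, k) = 0`
  (trivial module), (1c) `H¹(H, 𝔰𝔭(J)^∨) = 0` (Mathlib `groupCohomology.cocycles₁ ≤ coboundaries₁`,
  as (E1) in `GSp4BigImage.lean`), (2).
* `FramedGaloisRep.IsGSp4Reasonable J p ρ` — Def. 3.19 verbatim for `ρ̄ : G_F → GSp(J)(k)`:
  for all `n ≫ 0` (`∃ n₀ ∀ n ≥ n₀`), `H_n = ρ̄(G_{F(ζ_{p^n})})` (`imageOn (galCyclotomicPow F p n)`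
  of the sibling) lies in `GSp(J)(k)` and satisfies (1a) and (2), and IF "`ζ_p` is in the fixed
  field `L` of `ĝ^{0,∨}_k`" — every `σ` acting trivially on `𝔰𝔭(J)` through `Ad ρ̄(σ)` (i.e.
  `σ ∈ G_L`; the dual module has the same kernel) fixes the `p`-th roots of unity — THEN
  `H¹(H_n, 𝔰𝔭(J)^∨) = 0`.
* API (proved, no `sorry`): unfolding lemmas, `spLie_le_gspLie`, `mem_lieCenterCentralizer_iff`,
  `lieCenterCentralizer_le_gspLie`, `IsGSp4Adequate.subsingleton_H1`,
  `IsGSp4Reasonable.of_adequate`.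

## Design notes (what reviewers should check against print)

* `Ĝ = GSp₄` only: Whitmore's definitions are for a general split reductive `Ĝ`; here `Ĝ(k) =
  GSp(J)(k) = gspSubgroup J` (BCGP's group, §2.1 of the 2021 paper), `ĝ_k = gspLie J`,
  `ĝ⁰_k = spLie J` (the Lie algebra of the derived group `Sp(J)`; for `p = 2` the derived-group
  Lie algebra and `𝔰𝔭` differ in general — not the use case, `p = 3` in BCGP 2025, and Whitmore
  assumes `p` pretty good, Def. 2.6/Remark 2.8), `Ĝ(k̄) = gspSubgroup (J.map (k → k̄))`.
* "non-zero simple `k[H]`-submodule" = an atom of `Subrepresentation (spDualRep H hH)` (Mathlib's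
  bounded lattice of subrepresentations), exactly as (E3) is rendered in `GSp4BigImage.lean` and (3)
  in `EnormousSubgroup.lean`.
* "semisimple element": annihilated by a separable polynomial over `k` ⟺ the minimal polynomial is
  separable ⟺ diagonalisable over `k̄` (the algebraic-group meaning); for finite `k` (the use case)
  this is Mathlib's `Module.End.IsSemisimple` of the associated endomorphism, not used here to
  keep the clause elementary.
* `H¹(H, k) = 0` (1b), `k` the trivial module: `cocycles₁ ≤ coboundaries₁` for `Rep.trivial k H k`
  (for the trivial module the coboundaries vanish and the cocycles are `Hom(H, k)`).
* "for all sufficiently large `n`" = `∃ n₀, ∀ n ≥ n₀`, as in `FramedGaloisRep.IsVast`; the clause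
  "`ζ_p ∈ L`" does not depend on `n`.
* NOT here (results, wanted as theorems, not facts): Lemma 2.7 (`Lie Z(M_h) ∩ ĝ⁰ = 𝔷((ĝ⁰)^h)` for
  connected `M_h`), Lemma 3.16, Prop. 3.18 (existence of Taylor–Wiles primes), Lemma 3.20
  (adequate ⟹ reasonable), §4.3 Lemma 4.18 and Tables 4–5 (the 25 classes of `Γ′ ≤ GSp₄(𝔽₃)` with
  `ν(Γ′) ≠ 1` and `Γ′ ∩ Sp₄(𝔽₃)` absolutely irreducible; Magma), Thm. 7.12/7.13 (the lifting
  theorems with "reasonable and tidy").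

## References

* [Whitmore2022] D. Whitmore, *The Taylor–Wiles method for reductive groups*, arXiv:2205.05062
  (v4 2026): §1 p. 3 (notation `ĝ⁰`, `ĝ^{0,∨}`, `𝔷`), §2 p. 7 (`M_ḡ`, `Lie M_ḡ = 𝔏₀`), Lemma 2.7
  (p. 10), Def. 3.15 (p. 22), Lemma 3.16 (p. 22), Prop. 3.18, Def. 3.19 (pp. 23–24), Lemma 3.20
  (p. 24), §4.3 (p. 39) and Table 5 (p. 85), Thm. 7.13 (p. 69).  Published version:
  [Whitmore2026] Adv. Math. 493 (2026) 110915.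
* [BoxerCalegariGeePilloni2025] G. Boxer, F. Calegari, T. Gee, V. Pilloni, *Modularity theorems for
  abelian surfaces*, arXiv:2502.20645: Lemma 6.4.3 (1), Theorem 9.5.1 (5) ("`GSp₄`-reasonable in
  the sense of [Whitmore]").
* [BoxerEtAl2021] G. Boxer, F. Calegari, T. Gee, V. Pilloni, Publ. Math. IHÉS 134 (2021), §2.1
  (`GSp₄`), Def. 7.5.2 (`ad⁰ = 𝔰𝔭₄`).
-/

noncomputable section

open scoped MatrixGroups
open Matrix Polynomial

namespace Literature.NumberTheory.GaloisRepresentations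

universe u v

/-! ### `𝔤𝔰𝔭(J)`, semisimple elements, `Lie Z(M_h)` -/

section LieAlgebras

variable {k : Type u} [Field k] {n : ℕ}

/-- **`𝔤𝔰𝔭(J) = Lie GSp(J)`**: the `X ∈ M_n(k)` with `Xᵀ J + J X = c J` for some `c ∈ k` (the
`k[ε]`-points `1 + εX` of `GSp(J) = {g : gᵀ J g = ν J}`); Whitmore's `ĝ_k` for `Ĝ = GSp₄`.
[cite: Whitmore2022, §2 p. 7 (ĝ_k = Lie Ĝ_k) with BoxerEtAl2021 §2.1 (Ĝ = GSp₄)] -/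
def gspLie (J : Matrix (Fin n) (Fin n) k) : Submodule k (Matrix (Fin n) (Fin n) k) where
  carrier := {X | ∃ c : k, Xᵀ * J + J * X = c • J}
  add_mem' := by
    rintro X Y ⟨c, hc⟩ ⟨d, hd⟩
    refine ⟨c + d, ?_⟩
    rw [transpose_add, Matrix.add_mul, Matrix.mul_add, add_add_add_comm, hc, hd, add_smul]
  zero_mem' := ⟨0, by simp⟩
  smul_mem' a X := by
    rintro ⟨c, hc⟩
    refine ⟨a * c, ?_⟩
    rw [transpose_smul, Matrix.smul_mul, Matrix.mul_smul, ← smul_add, hc, smul_smul]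

/-- Membership in `𝔤𝔰𝔭(J)` (unfolding). [cite: Whitmore2022, §2 p. 7 (ĝ_k)] -/
@[simp] lemma mem_gspLie_iff (J X : Matrix (Fin n) (Fin n) k) :
    X ∈ gspLie J ↔ ∃ c : k, Xᵀ * J + J * X = c • J := Iff.rfl

/-- `𝔰𝔭(J) ≤ 𝔤𝔰𝔭(J)` (`c = 0`): Whitmore's `ĝ⁰_k ⊂ ĝ_k` for `Ĝ = GSp₄`.
[cite: Whitmore2022, §1 p. 3 (ĝ⁰ = Lie of the derived group, inside ĝ)] -/
lemma spLie_le_gspLie (J : Matrix (Fin n) (Fin n) k) : spLie J ≤ gspLie J := by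
  intro X hX
  rw [mem_spLie_iff] at hX
  exact ⟨0, by rw [hX, zero_smul]⟩

/-- **`g ∈ GL_n(k)` is a semisimple element**: it is annihilated by a separable polynomial over `k`
(equivalently its minimal polynomial is separable, i.e. `g` is diagonalisable over `k̄` — the
meaning of "semisimple element `h ∈ H`" in Whitmore Def. 3.15 (2)). [cite: Whitmore2022, §2 p. 7 and Def. 3.15 (2) ("semisimple element h ∈ H")] -/
def IsSemisimpleElt (g : GL (Fin n) k) : Prop :=
  ∃ P : k[X], P.Separable ∧ aeval ((g : GL (Fin n) k) : Matrix (Fin n) (Fin n) k) P = 0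

/-- Unfolding lemma for `IsSemisimpleElt`. [cite: Whitmore2022, Def. 3.15 (2)] -/
lemma isSemisimpleElt_iff (g : GL (Fin n) k) :
    IsSemisimpleElt g ↔
      ∃ P : k[X], P.Separable ∧ aeval ((g : GL (Fin n) k) : Matrix (Fin n) (Fin n) k) P = 0 :=
  Iff.rfl

/-- **`Lie Z(M_h)` for `M_h = Z_{GSp(J)_k}(h)`** (Whitmore §2, Def. 3.15 (2)), in matrices: the
`X ∈ 𝔤𝔰𝔭(J)_k` commuting with `h` (i.e. `X ∈ Lie M_h = ĝ_k^{Ad h}`) and fixed by `Ad(m)` for every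
`m ∈ GSp(J)(k̄)` commuting with `h`, `k̄ = AlgebraicClosure k`.  For semisimple `h` (`M_h` smooth,
loc. cit.) this is the Lie algebra of the scheme-theoretic centre `Z(M_h)` (module docstring,
"READING"); Def. 3.15 (2) uses `Lie Z(M_h) ∩ ĝ⁰_k`, i.e. the members of this space lying in `𝔰𝔭(J)`.
[cite: Whitmore2022, §2 p. 7 (M_ḡ = Z_{Ĝ_k}(ḡ), Lie M_ḡ = 𝔏₀) and Def. 3.15 (2) (Lie Z(M_h))] -/
def lieCenterCentralizer (J : Matrix (Fin n) (Fin n) k) (h : GL (Fin n) k) :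
    Submodule k (Matrix (Fin n) (Fin n) k) where
  carrier := {X | X ∈ gspLie J ∧
    ((h : GL (Fin n) k) : Matrix (Fin n) (Fin n) k) * X = X * ((h : GL (Fin n) k) : Matrix _ _ k) ∧
    ∀ m : GL (Fin n) (AlgebraicClosure k),
      m ∈ gspSubgroup (J.map (algebraMap k (AlgebraicClosure k))) →
      ((m : GL (Fin n) (AlgebraicClosure k)) : Matrix (Fin n) (Fin n) (AlgebraicClosure k)) *
          (((h : GL (Fin n) k) : Matrix (Fin n) (Fin n) k).map (algebraMap k (AlgebraicClosure k))) =
        (((h : GL (Fin n) k) : Matrix (Fin n) (Fin n) k).map (algebraMap k (AlgebraicClosure k))) *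
          ((m : GL (Fin n) (AlgebraicClosure k)) : Matrix (Fin n) (Fin n) (AlgebraicClosure k)) →
      ((m : GL (Fin n) (AlgebraicClosure k)) : Matrix (Fin n) (Fin n) (AlgebraicClosure k)) *
          X.map (algebraMap k (AlgebraicClosure k)) *
          ((m⁻¹ : GL (Fin n) (AlgebraicClosure k)) : Matrix (Fin n) (Fin n) (AlgebraicClosure k)) =
        X.map (algebraMap k (AlgebraicClosure k))}
  add_mem' := by
    rintro X Y ⟨hX, hXh, hXm⟩ ⟨hY, hYh, hYm⟩
    refine ⟨(gspLie J).add_mem hX hY, ?_, fun m hm hmh => ?_⟩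
    · rw [Matrix.mul_add, Matrix.add_mul, hXh, hYh]
    · rw [Matrix.map_add (algebraMap k (AlgebraicClosure k)) (map_add _), Matrix.mul_add,
        Matrix.add_mul, hXm m hm hmh, hYm m hm hmh]
  zero_mem' := by
    refine ⟨(gspLie J).zero_mem, by simp, fun m _ _ => ?_⟩
    simp
  smul_mem' a X := by
    rintro ⟨hX, hXh, hXm⟩
    refine ⟨(gspLie J).smul_mem a hX, ?_, fun m hm hmh => ?_⟩
    · rw [Matrix.mul_smul, Matrix.smul_mul, hXh]
    · rw [Matrix.map_smul' (algebraMap k (AlgebraicClosure k)) a X (map_mul _), Matrix.mul_smul,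
        Matrix.smul_mul, hXm m hm hmh]

/-- Membership in `lieCenterCentralizer J h` (unfolding of the rendering of `Lie Z(M_h)`). [cite: Whitmore2022, Def. 3.15 (2) (Lie Z(M_h))] -/
lemma mem_lieCenterCentralizer_iff (J : Matrix (Fin n) (Fin n) k) (h : GL (Fin n) k)
    (X : Matrix (Fin n) (Fin n) k) :
    X ∈ lieCenterCentralizer J h ↔
      X ∈ gspLie J ∧
      ((h : GL (Fin n) k) : Matrix (Fin n) (Fin n) k) * X = X * ((h : GL (Fin n) k) : Matrix _ _ k) ∧
      ∀ m : GL (Fin n) (AlgebraicClosure k),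
        m ∈ gspSubgroup (J.map (algebraMap k (AlgebraicClosure k))) →
        ((m : GL (Fin n) (AlgebraicClosure k)) : Matrix (Fin n) (Fin n) (AlgebraicClosure k)) *
            (((h : GL (Fin n) k) : Matrix (Fin n) (Fin n) k).map
              (algebraMap k (AlgebraicClosure k))) =
          (((h : GL (Fin n) k) : Matrix (Fin n) (Fin n) k).map (algebraMap k (AlgebraicClosure k))) *
            ((m : GL (Fin n) (AlgebraicClosure k)) : Matrix (Fin n) (Fin n) (AlgebraicClosure k)) →
        ((m : GL (Fin n) (AlgebraicClosure k)) : Matrix (Fin n) (Fin n) (AlgebraicClosure k)) *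
            X.map (algebraMap k (AlgebraicClosure k)) *
            ((m⁻¹ : GL (Fin n) (AlgebraicClosure k)) : Matrix (Fin n) (Fin n) (AlgebraicClosure k)) =
          X.map (algebraMap k (AlgebraicClosure k)) :=
  Iff.rfl

/-- `Lie Z(M_h) ≤ 𝔤𝔰𝔭(J)` (it is a subspace of `ĝ_k`). [cite: Whitmore2022, §2 p. 7, Def. 3.15 (2)] -/
lemma lieCenterCentralizer_le_gspLie (J : Matrix (Fin n) (Fin n) k) (h : GL (Fin n) k) :
    lieCenterCentralizer J h ≤ gspLie J := fun _ hX => hX.1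

end LieAlgebras

/-! ### The dual module `𝔰𝔭(J)^∨` and Def. 3.15 for `Ĝ = GSp₄` -/

section Adequate

variable {k : Type u} [Field k] {n : ℕ}

/-- The `k[H]`-module **`ĝ^{0,∨}_k = 𝔰𝔭(J)^∨`** of a subgroup `H ≤ GSp(J)(k)`: the dual
(Mathlib `Representation.dual`, `(h · w)(z) = w(h⁻¹ z h)`) of the adjoint module `ad⁰ = 𝔰𝔭(J)`
(`Subgroup.spAdRep H hH` of `GSp4BigImage.lean`).  Declared in the topic namespace (write
`Subgroup.spDualRep H hH` after `open Literature.NumberTheory.GaloisRepresentations`).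
[cite: Whitmore2022, §1 p. 3 ("ĝ^{0,∨} denotes the dual module") and Def. 3.15] -/
abbrev Subgroup.spDualRep {J : Matrix (Fin n) (Fin n) k} (H : Subgroup (GL (Fin n) k))
    (hH : H ≤ gspSubgroup J) : Representation k H (Module.Dual k (spLie J)) :=
  (Subgroup.spAdRep H hH).dual

/-- Unfolding: `h ∈ H` acts on `w ∈ 𝔰𝔭(J)^∨` by `(h · w)(z) = w(h⁻¹ · z)` (Mathlib
`Representation.dual_apply`). [cite: Whitmore2022, §1 p. 3 (dual module)] -/
lemma Subgroup.spDualRep_apply_apply {J : Matrix (Fin n) (Fin n) k} (H : Subgroup (GL (Fin n) k))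
    (hH : H ≤ gspSubgroup J) (h : H) (w : Module.Dual k (spLie J)) (z : spLie J) :
    Subgroup.spDualRep H hH h w z = w (Subgroup.spAdRep H hH h⁻¹ z) := by
  simp [Subgroup.spDualRep, Representation.dual_apply, Module.Dual.transpose_apply]

/-- **Def. 3.15 (1a) for `Ĝ = GSp₄`**: `H⁰(H, 𝔰𝔭(J)^∨) = 0` — the `k[H]`-module `𝔰𝔭(J)^∨` has no
non-zero `H`-invariant vector. [cite: Whitmore2022, Def. 3.15 (1)(a) (p. 22)] -/
def Subgroup.SpDualInvariantsEqBot (J : Matrix (Fin n) (Fin n) k) (H : Subgroup (GL (Fin n) k))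
    (hH : H ≤ gspSubgroup J) : Prop :=
  (Subgroup.spDualRep H hH).invariants = ⊥

/-- Unfolding lemma for `Subgroup.SpDualInvariantsEqBot`. [cite: Whitmore2022, Def. 3.15 (1)(a)] -/
lemma Subgroup.spDualInvariantsEqBot_iff (J : Matrix (Fin n) (Fin n) k)
    (H : Subgroup (GL (Fin n) k)) (hH : H ≤ gspSubgroup J) :
    Subgroup.SpDualInvariantsEqBot J H hH ↔ (Subgroup.spDualRep H hH).invariants = ⊥ :=
  Iff.rfl

/-- **Def. 3.15 (2) for `Ĝ = GSp₄`** (the "spanning condition", §4.3): for every non-zero simple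
`k[H]`-submodule `W ≤ 𝔰𝔭(J)^∨` (an atom of the lattice of subrepresentations) there is a
semisimple `h ∈ H` such that `w(z) ≠ 0` for some `w ∈ W` and some
`z ∈ Lie Z(M_h) ∩ 𝔰𝔭(J)` (`lieCenterCentralizer J h`, members lying in `spLie J`).
[cite: Whitmore2022, Def. 3.15 (2) (p. 22); §4.3 p. 39 ("our spanning condition")] -/
def Subgroup.HasGSp4Spanning (J : Matrix (Fin n) (Fin n) k) (H : Subgroup (GL (Fin n) k))
    (hH : H ≤ gspSubgroup J) : Prop :=
  ∀ W : Subrepresentation (Subgroup.spDualRep H hH), IsAtom W →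
    ∃ h : H, IsSemisimpleElt (h : GL (Fin n) k) ∧
      ∃ w ∈ W, ∃ z : spLie J,
        (z : Matrix (Fin n) (Fin n) k) ∈ lieCenterCentralizer J (h : GL (Fin n) k) ∧
          (w : Module.Dual k (spLie J)) z ≠ 0

/-- Unfolding lemma for `Subgroup.HasGSp4Spanning` (the cited condition verbatim). [cite: Whitmore2022, Def. 3.15 (2)] -/
lemma Subgroup.hasGSp4Spanning_iff (J : Matrix (Fin n) (Fin n) k) (H : Subgroup (GL (Fin n) k))
    (hH : H ≤ gspSubgroup J) :
    Subgroup.HasGSp4Spanning J H hH ↔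
      ∀ W : Subrepresentation (Subgroup.spDualRep H hH), IsAtom W →
        ∃ h : H, IsSemisimpleElt (h : GL (Fin n) k) ∧
          ∃ w ∈ W, ∃ z : spLie J,
            (z : Matrix (Fin n) (Fin n) k) ∈ lieCenterCentralizer J (h : GL (Fin n) k) ∧
              (w : Module.Dual k (spLie J)) z ≠ 0 :=
  Iff.rfl

/-- **`H ≤ GSp₄(k)` is `Ĝ`-adequate, `Ĝ = GSp₄`** (Whitmore Def. 3.15), for the form with Gram
matrix `J`:
* `le_gsp` — `H ≤ GSp(J)(k)`;
* `spDualInvariantsEqBot` — (1a) `H⁰(H, 𝔰𝔭(J)^∨) = 0`;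
* `trivial_cocycles₁_le` — (1b) `H¹(H, k) = 0` for the trivial module `k`
  (`groupCohomology.cocycles₁ ≤ coboundaries₁` for `Rep.trivial k H k`);
* `cocycles₁_le_coboundaries₁` — (1c) `H¹(H, 𝔰𝔭(J)^∨) = 0` (same rendering as (E1) in
  `GSp4BigImage.lean`);
* `hasGSp4Spanning` — (2).
[cite: Whitmore2022, Def. 3.15 (p. 22 L6–13)] -/
structure Subgroup.IsGSp4Adequate (J : Matrix (Fin 4) (Fin 4) k) (H : Subgroup (GL (Fin 4) k)) :
    Prop where
  /-- `H` lies in the similitude group of `J`. -/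
  le_gsp : H ≤ gspSubgroup J
  /-- (1a) `H⁰(H, 𝔰𝔭(J)^∨) = 0`. -/
  spDualInvariantsEqBot : Subgroup.SpDualInvariantsEqBot J H le_gsp
  /-- (1b) `H¹(H, k) = 0` (`k` with the trivial action). -/
  trivial_cocycles₁_le :
    groupCohomology.cocycles₁ (Rep.trivial k H k) ≤ groupCohomology.coboundaries₁ (Rep.trivial k H k)
  /-- (1c) `H¹(H, 𝔰𝔭(J)^∨) = 0`. -/
  cocycles₁_le_coboundaries₁ :
    groupCohomology.cocycles₁ (Rep.of (Subgroup.spDualRep H le_gsp)) ≤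
      groupCohomology.coboundaries₁ (Rep.of (Subgroup.spDualRep H le_gsp))
  /-- (2) the spanning condition. -/
  hasGSp4Spanning : Subgroup.HasGSp4Spanning J H le_gsp

/-- (1c) in Mathlib's group cohomology: for a `GSp₄`-adequate `H`, `H¹(H, 𝔰𝔭(J)^∨) = 0`
(`groupCohomology.H1` is a subsingleton), as for (E1) in `GSp4BigImage.lean`.
[cite: Whitmore2022, Def. 3.15 (1)(c)] -/
theorem Subgroup.IsGSp4Adequate.subsingleton_H1 {J : Matrix (Fin 4) (Fin 4) k}
    {H : Subgroup (GL (Fin 4) k)} (hH : Subgroup.IsGSp4Adequate J H) :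
    Subsingleton (groupCohomology.H1 (Rep.of (Subgroup.spDualRep H hH.le_gsp))) := by
  refine ⟨fun x y => ?_⟩
  have h0 : ∀ z : groupCohomology.H1 (Rep.of (Subgroup.spDualRep H hH.le_gsp)), z = 0 := by
    intro z
    induction z using groupCohomology.H1_induction_on with
    | h f =>
      rw [groupCohomology.H1π_eq_zero_iff]
      exact hH.cocycles₁_le_coboundaries₁ f.2
  rw [h0 x, h0 y]

end Adequate

/-! ### Def. 3.19: `GSp₄`-reasonable representations -/

section Reasonable

variable {F : Type v} [Field F] {k : Type u} [Field k] [TopologicalSpace k]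

/-- **`ρ̄ : G_F → GSp₄(k)` is `Ĝ`-reasonable, `Ĝ = GSp₄`** (Whitmore Def. 3.19), for the form
`J` and the prime `p`: for all sufficiently large `n` (`∃ n₀, ∀ n ≥ n₀`), the image
`H_n = ρ̄(G_{F(ζ_{p^n})})` (`ρ.imageOn (galCyclotomicPow F p n)`) lies in `GSp(J)(k)` and
(1) satisfies conditions (1a) `H⁰(H_n, 𝔰𝔭(J)^∨) = 0` and (2) (spanning) of Def. 3.15, and
(2) IF `ζ_p` lies in the fixed field `L` of `ĝ^{0,∨}_k` — every `σ ∈ Γ_F` acting trivially on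
`𝔰𝔭(J)` by `X ↦ ρ̄(σ) X ρ̄(σ)⁻¹` (equivalently on its dual) fixes every `p`-th root of unity
(`σ ∈ galCyclotomicPow F p 1`) — THEN `H¹(H_n, 𝔰𝔭(J)^∨) = 0`.
[cite: Whitmore2022, Def. 3.19 (pp. 23–24), with Def. 3.15 (1)(a), (2) and Lemma 3.16 ("L the fixed field of the module ĝ^{0,∨}_k")] -/
def FramedGaloisRep.IsGSp4Reasonable (J : Matrix (Fin 4) (Fin 4) k) (p : ℕ)
    (ρ : FramedGaloisRep F k 4) : Prop :=
  ∃ n₀ : ℕ, ∀ n ≥ n₀,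
    ∃ hle : ρ.imageOn (galCyclotomicPow F p n) ≤ gspSubgroup J,
      Subgroup.SpDualInvariantsEqBot J (ρ.imageOn (galCyclotomicPow F p n)) hle ∧
      Subgroup.HasGSp4Spanning J (ρ.imageOn (galCyclotomicPow F p n)) hle ∧
      ((∀ σ : Field.absoluteGaloisGroup F,
          (∀ X ∈ spLie J,
            ((ρ σ : GL (Fin 4) k) : Matrix (Fin 4) (Fin 4) k) * X *
              (((ρ σ)⁻¹ : GL (Fin 4) k) : Matrix (Fin 4) (Fin 4) k) = X) →
          σ ∈ galCyclotomicPow F p 1) →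
        groupCohomology.cocycles₁ (Rep.of (Subgroup.spDualRep (ρ.imageOn (galCyclotomicPow F p n)) hle)) ≤
          groupCohomology.coboundaries₁
            (Rep.of (Subgroup.spDualRep (ρ.imageOn (galCyclotomicPow F p n)) hle)))

/-- Unfolding lemma for `FramedGaloisRep.IsGSp4Reasonable` (the cited definition verbatim). [cite: Whitmore2022, Def. 3.19] -/
lemma FramedGaloisRep.isGSp4Reasonable_iff (J : Matrix (Fin 4) (Fin 4) k) (p : ℕ)
    (ρ : FramedGaloisRep F k 4) :
    ρ.IsGSp4Reasonable J p ↔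
      ∃ n₀ : ℕ, ∀ n ≥ n₀,
        ∃ hle : ρ.imageOn (galCyclotomicPow F p n) ≤ gspSubgroup J,
          Subgroup.SpDualInvariantsEqBot J (ρ.imageOn (galCyclotomicPow F p n)) hle ∧
          Subgroup.HasGSp4Spanning J (ρ.imageOn (galCyclotomicPow F p n)) hle ∧
          ((∀ σ : Field.absoluteGaloisGroup F,
              (∀ X ∈ spLie J,
                ((ρ σ : GL (Fin 4) k) : Matrix (Fin 4) (Fin 4) k) * X *
                  (((ρ σ)⁻¹ : GL (Fin 4) k) : Matrix (Fin 4) (Fin 4) k) = X) →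
              σ ∈ galCyclotomicPow F p 1) →
            groupCohomology.cocycles₁
                (Rep.of (Subgroup.spDualRep (ρ.imageOn (galCyclotomicPow F p n)) hle)) ≤
              groupCohomology.coboundaries₁
                (Rep.of (Subgroup.spDualRep (ρ.imageOn (galCyclotomicPow F p n)) hle))) :=
  Iff.rfl

/-- If the images `ρ̄(G_{F(ζ_{p^n})})`, `n ≫ 0`, lie in `GSp(J)(k)` and satisfy (1a), (2) AND
(1c) unconditionally (e.g. they are `GSp₄`-adequate), then `ρ̄` is `GSp₄`-reasonable — the
trivial direction of the remark after Def. 3.19 (Lemma 3.20 adds that for `H¹(ρ̄(G_{F(ζ_p)}), k)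
= 0` the images do not depend on `n`, which is not proved here). [cite: Whitmore2022, Def. 3.19 and Lemma 3.20] -/
theorem FramedGaloisRep.IsGSp4Reasonable.of_adequate {J : Matrix (Fin 4) (Fin 4) k} {p : ℕ}
    {ρ : FramedGaloisRep F k 4}
    (h : ∃ n₀ : ℕ, ∀ n ≥ n₀, Subgroup.IsGSp4Adequate J (ρ.imageOn (galCyclotomicPow F p n))) :
    ρ.IsGSp4Reasonable J p := by
  obtain ⟨n₀, hn₀⟩ := h
  refine ⟨n₀, fun n hn => ?_⟩
  obtain ⟨hle, h1a, -, h1c, h2⟩ := hn₀ n hn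
  exact ⟨hle, h1a, h2, fun _ => h1c⟩

end Reasonable

end Literature.NumberTheory.GaloisRepresentations
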